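/-
Copyright (c) 2026 the pub-hodgecm-mathlib formalisation cell (harness21).  Prover seat hodgecm-mathlib-A-p03 (g24); LEAD F0P3a-plan (g9) WORD T8-41 «(F4)–(F8) PEN 1»,
architect A-p06 (g26) MAP v3 §2 (F6)–(F8), 2026-09-01.
-/
import Literature.NumberTheory.Rogawski1990.UnitOrbitalIntegralInertSumsThetaOne
import HarnessLib

/-!
# Flicker's unit orbital integrals at an inert place — THE SUMMATION IDENTITY «Cor. 9 + Props. 10, 12, 13 ⇒ Prop. 14» (`θ̄ = 0`), kernel-checked

Topic `NumberTheory/Rogawski1990` (road «D-N7-inert», MAP v3 (F6)–(F8), LAYER A of `CENSUS-F4-F8-FlickerCongruenceVolumes.A-p03g24.md`); namespace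
`Literature.NumberTheory.Rogawski1990.Flicker1998`.  THEOREMS ONLY (no `def`, no instance, no notation, no named fact, no `sorry`); kernel lane.

THE MATHEMATICS [Flicker1998UnitaryFL, Cor. 9 p. 85, Props. 12–14 pp. 90–94].  For `θ̄ = 0` Cor. 9 reads `Φ(t_θ) = Σ_m I(0,m) + Σ_{j even ≥ 2} [R_E^× : R_E(j)^×] Σ_m I(j,m)`
with `I(0,m)` the table of Prop. 13 (★ `iThirteen`) and `I(j,m)`, `j ≥ 1`, the table of Prop. 10 (★ `iTen`); Prop. 12 sums the `j > 0` part, Prop. 14 adds Prop. 13's.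
This file proves, as identities of rational functions for all `q > 1`:
* `sumThetaZeroJ_succ` — **Prop. 12 is `q ×` Prop. 11 one step down**: `Σ_{j even, 2 ≤ j ≤ N+1} w(j) S(N+1−j) = q · Σ_{j odd ≤ N} w(j) S(N−j)` (same `ν`-set, `w(j+1) = q w(j)`),
  whence `sumThetaZeroJ q N N₊ = q · phiOne q N₊ (N − 1)` (`sumThetaZeroJ_eq`) — Flicker's p. 90 closed forms without re-summing;
* `innerSumThirteen_eq_of_le` ∕ `_of_lt` — Prop. 13's table summed over `m` in closed form: for `N ≤ N₊`, `N ≤ M` the five cases (a)–(e) tile `[1, [(M+N)∕2]]` into THREE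
  consecutive blocks `[1,[N∕2]] ∪ ([N∕2],[M∕2]] ∪ ([M∕2],[(M+N)∕2]]` ((b)∪(d) and (c)∪(e) are contiguous), giving
  `1 + (1−q⁻²)Σ q^{4m} + (1+q⁻¹)q^{2[N∕2]} Σ q^{2m} + δ(2 ∣ M−N)(1+q⁻¹)² q^N Σ q^{2m}`; for `N₊ < N` only (a) survives;
* **`sumThetaZero_eq_of_le`** (`N ≤ N₊`, `N ≤ M`): `Σ = −A(1+q^{2+4[N∕2]}) − (−q)^{M+N}∕(q−1) + δ(2 ∣ M−N)·B·q^{2N+M}` (`A = (q+1)∕(q⁴−1)`, `B = (q+1)∕(q−1)`) and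
  **`sumThetaZero_eq_phiZero_of_lt`** (`N₊ < N`): `Σ (M = N₊) = phiZero q N₊ N₊ N`; packaged in Flicker's frame as **`sumThetaZero_eq_phiZero`**: in either elliptic regime
  («`N₊ = N₁ = N₂ < N`» or «`N ≤ N₁`, `N ≤ N₊`», `M = max N₁ N₂`) Cor. 9's sum over the printed tables IS Prop. 14's ★ `phiZero q N₁ N₂ N`.
So of Props. 11–14 only the VOLUME statements of Props. 10 and 13 (LAYER B) remain to be proved in-house; every summation∕closed-form step of Flicker §4–§5 and THM 15 (★
`flicker_theorem15`) is now kernel arithmetic.  Numerically pre-certified: `F0/P3a/A-p03/g24/flicker_tables.A-p03g24.py` (07557992).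
HONEST LABEL: HC_CM is proved only modulo the printed citations until rung 0 closes; this file is arithmetic.

## References
* [Flicker1998UnitaryFL] Y. Z. Flicker, *Elementary proof of the fundamental lemma for a unitary group*, Canad. J. Math. 50 (1998), 74–98: Cor. 9 p. 85, Prop. 10 p. 85,
  Prop. 12 p. 90, Prop. 13 p. 91, Prop. 14 p. 94.
* [Rogawski1990] J. D. Rogawski, *Automorphic Representations of Unitary Groups in Three Variables* (1990), §4.9 Prop. 4.9.1 (b) p. 55.
-/

set_option autoImplicit false

namespace Literature.NumberTheory.Rogawski1990.Flicker1998

open Finset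

variable {q : ℕ}

/-! ## §1 Prop. 12 = `q ×` Prop. 11 -/

/-- `w(j + 1) = q · w(j)` for `j ≥ 1`. [cite: Flicker1998UnitaryFL, Cor. 9 p. 85] -/
theorem corNineWeight_add_one {j : ℕ} (hj : j ≠ 0) : corNineWeight q (j + 1) = (q : ℚ) * corNineWeight q j := by
  simp only [corNineWeight, if_neg hj, if_neg (Nat.succ_ne_zero j), pow_succ]
  ring

/-- `Σ_{j even ≥ 2}` at `0` is empty. [cite: Flicker1998UnitaryFL, Prop. 12 p. 90] -/
theorem sumThetaZeroJ_zero (q Np : ℕ) : sumThetaZeroJ q 0 Np = 0 := by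
  simp [sumThetaZeroJ]

/-- **Prop. 12's sum is `q ×` Prop. 11's one step down**: `Σ_{j even, 2 ≤ j ≤ N+1} w(j) S(N+1−j) = q · Σ_{j odd ≤ N} w(j) S(N−j)` (the same set of `ν = N+1−j`, and
`w(j+1) = q·w(j)`). [cite: Flicker1998UnitaryFL, Prop. 12 p. 90; Cor. 9 p. 85] -/
theorem sumThetaZeroJ_succ (q N Np : ℕ) : sumThetaZeroJ q (N + 1) Np = (q : ℚ) * sumThetaOne q N Np := by
  unfold sumThetaZeroJ sumThetaOne
  rw [Finset.sum_range_succ, Finset.mul_sum]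
  have htop : ¬ (N + 1 - N) % 2 = 0 := by omega
  rw [if_neg htop, add_zero]
  refine Finset.sum_congr rfl fun ν hν => ?_
  rw [Finset.mem_range] at hν
  have hsub : N + 1 - ν = (N - ν) + 1 := by omega
  have hne : N - ν ≠ 0 := by omega
  rw [hsub, corNineWeight_add_one hne]
  by_cases h : (N - ν) % 2 = 1
  · rw [if_pos (by omega : (N - ν + 1) % 2 = 0), if_pos h]; ring
  · rw [if_neg (by omega : ¬ (N - ν + 1) % 2 = 0), if_neg h]; ring

/-- **Prop. 12 in closed form**: `Σ_{j even ≥ 2} w(j) Σ_m I(j,m) = q · φ₁(N₊, N − 1)`. [cite: Flicker1998UnitaryFL, Prop. 12 p. 90] -/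
theorem sumThetaZeroJ_eq (hq : 1 < q) (N Np : ℕ) : sumThetaZeroJ q N Np = (q : ℚ) * phiOne q Np (N - 1) := by
  rcases N with _ | N
  · rw [sumThetaZeroJ_zero, Nat.zero_sub, phiOne_zero, mul_zero]
  · rw [sumThetaZeroJ_succ, sumThetaOne_eq_phiOne hq, Nat.add_sub_cancel]

/-! ## §2 Prop. 13's table summed over `m` -/

/-- **Prop. 13's table summed, regime `N ≤ N₊`, `N ≤ M`**: the cases (a) ∣ (b)∪(d) ∣ (c)∪(e) tile three consecutive blocks of `m`.
[cite: Flicker1998UnitaryFL, Prop. 13 p. 91; Prop. 14 p. 94] -/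
theorem innerSumThirteen_eq_of_le (q : ℕ) {N Np M : ℕ} (hN : N ≤ Np) (hM : N ≤ M) :
    innerSumThirteen q N Np M = 1 + (1 - ((q : ℚ) ^ 2)⁻¹) * ∑ m ∈ Ico 1 (N / 2 + 1), (q : ℚ) ^ (4 * m)
      + (1 + ((q : ℚ))⁻¹) * (q : ℚ) ^ (2 * (N / 2)) * ∑ m ∈ Ico (N / 2 + 1) (M / 2 + 1), (q : ℚ) ^ (2 * m)
      + (if (M - N) % 2 = 0 then (1 + ((q : ℚ))⁻¹) ^ 2 * (q : ℚ) ^ N * ∑ m ∈ Ico (M / 2 + 1) ((M + N) / 2 + 1), (q : ℚ) ^ (2 * m) else 0) := by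
  unfold innerSumThirteen
  rw [Finset.range_eq_Ico, Finset.sum_eq_sum_Ico_succ_bot (by omega : 0 < M + N + 1),
    ← Finset.sum_Ico_consecutive _ (by omega : 1 ≤ N / 2 + 1) (by omega : N / 2 + 1 ≤ M + N + 1),
    ← Finset.sum_Ico_consecutive _ (by omega : N / 2 + 1 ≤ M / 2 + 1) (by omega : M / 2 + 1 ≤ M + N + 1),
    ← Finset.sum_Ico_consecutive _ (by omega : M / 2 + 1 ≤ (M + N) / 2 + 1) (by omega : (M + N) / 2 + 1 ≤ M + N + 1)]
  have h0 : iThirteen q N Np M 0 = 1 := by simp [iThirteen]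
  have hA : ∑ m ∈ Ico 1 (N / 2 + 1), iThirteen q N Np M m = (1 - ((q : ℚ) ^ 2)⁻¹) * ∑ m ∈ Ico 1 (N / 2 + 1), (q : ℚ) ^ (4 * m) := by
    rw [Finset.mul_sum]
    refine Finset.sum_congr rfl fun m hm => ?_
    rw [Finset.mem_Ico] at hm
    have h1 : m ≠ 0 := by omega
    have h2 : m ≤ min (N / 2) (Np / 2) := by omega
    simp only [iThirteen, if_neg h1, if_pos h2]
  have hBD : ∑ m ∈ Ico (N / 2 + 1) (M / 2 + 1), iThirteen q N Np M m =
      (1 + ((q : ℚ))⁻¹) * (q : ℚ) ^ (2 * (N / 2)) * ∑ m ∈ Ico (N / 2 + 1) (M / 2 + 1), (q : ℚ) ^ (2 * m) := by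
    rw [Finset.mul_sum]
    refine Finset.sum_congr rfl fun m hm => ?_
    rw [Finset.mem_Ico] at hm
    have h1 : m ≠ 0 := by omega
    have h2 : ¬ m ≤ min (N / 2) (Np / 2) := by omega
    have hval : (1 + ((q : ℚ))⁻¹) * (q : ℚ) ^ (2 * m + 2 * (N / 2)) = (1 + ((q : ℚ))⁻¹) * (q : ℚ) ^ (2 * (N / 2)) * (q : ℚ) ^ (2 * m) := by
      rw [pow_add]; ring
    by_cases hmN : m ≤ N
    · have h3 : N ≤ Np ∧ N / 2 + 1 ≤ m ∧ m ≤ min N (M / 2) := ⟨hN, by omega, by omega⟩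
      simp only [iThirteen, if_neg h1, if_neg h2, if_pos h3, hval]
    · have h3 : ¬ (N ≤ Np ∧ N / 2 + 1 ≤ m ∧ m ≤ min N (M / 2)) := by omega
      have h4 : ¬ (N ≤ Np ∧ M / 2 + 1 ≤ m ∧ m ≤ N ∧ (M - N) % 2 = 0) := by omega
      have h5 : N ≤ Np ∧ N + 1 ≤ m ∧ m ≤ M / 2 := ⟨hN, by omega, by omega⟩
      simp only [iThirteen, if_neg h1, if_neg h2, if_neg h3, if_neg h4, if_pos h5, hval]
  have hCE : ∑ m ∈ Ico (M / 2 + 1) ((M + N) / 2 + 1), iThirteen q N Np M m =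
      (if (M - N) % 2 = 0 then (1 + ((q : ℚ))⁻¹) ^ 2 * (q : ℚ) ^ N * ∑ m ∈ Ico (M / 2 + 1) ((M + N) / 2 + 1), (q : ℚ) ^ (2 * m) else 0) := by
    by_cases hpar : (M - N) % 2 = 0
    · rw [if_pos hpar, Finset.mul_sum]
      refine Finset.sum_congr rfl fun m hm => ?_
      rw [Finset.mem_Ico] at hm
      have h1 : m ≠ 0 := by omega
      have h2 : ¬ m ≤ min (N / 2) (Np / 2) := by omega
      have h3 : ¬ (N ≤ Np ∧ N / 2 + 1 ≤ m ∧ m ≤ min N (M / 2)) := by omega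
      have hval : (1 + ((q : ℚ))⁻¹) ^ 2 * (q : ℚ) ^ (2 * m + N) = (1 + ((q : ℚ))⁻¹) ^ 2 * (q : ℚ) ^ N * (q : ℚ) ^ (2 * m) := by
        rw [pow_add]; ring
      by_cases hmN : m ≤ N
      · have h4 : N ≤ Np ∧ M / 2 + 1 ≤ m ∧ m ≤ N ∧ (M - N) % 2 = 0 := ⟨hN, by omega, hmN, hpar⟩
        simp only [iThirteen, if_neg h1, if_neg h2, if_neg h3, if_pos h4, hval]
      · have h4 : ¬ (N ≤ Np ∧ M / 2 + 1 ≤ m ∧ m ≤ N ∧ (M - N) % 2 = 0) := by omega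
        have h5 : ¬ (N ≤ Np ∧ N + 1 ≤ m ∧ m ≤ M / 2) := by omega
        have h6 : N ≤ Np ∧ max (N + 1) (M / 2 + 1) ≤ m ∧ m ≤ (M + N) / 2 ∧ (M - N) % 2 = 0 := ⟨hN, by omega, by omega, hpar⟩
        simp only [iThirteen, if_neg h1, if_neg h2, if_neg h3, if_neg h4, if_neg h5, if_pos h6, hval]
    · rw [if_neg hpar]
      refine Finset.sum_eq_zero fun m hm => ?_
      rw [Finset.mem_Ico] at hm
      have h1 : m ≠ 0 := by omega
      have h2 : ¬ m ≤ min (N / 2) (Np / 2) := by omega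
      have h3 : ¬ (N ≤ Np ∧ N / 2 + 1 ≤ m ∧ m ≤ min N (M / 2)) := by omega
      have h4 : ¬ (N ≤ Np ∧ M / 2 + 1 ≤ m ∧ m ≤ N ∧ (M - N) % 2 = 0) := by omega
      have h5 : ¬ (N ≤ Np ∧ N + 1 ≤ m ∧ m ≤ M / 2) := by omega
      have h6 : ¬ (N ≤ Np ∧ max (N + 1) (M / 2 + 1) ≤ m ∧ m ≤ (M + N) / 2 ∧ (M - N) % 2 = 0) := by omega
      simp only [iThirteen, if_neg h1, if_neg h2, if_neg h3, if_neg h4, if_neg h5, if_neg h6]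
  have hZ : ∑ m ∈ Ico ((M + N) / 2 + 1) (M + N + 1), iThirteen q N Np M m = 0 := by
    refine Finset.sum_eq_zero fun m hm => ?_
    rw [Finset.mem_Ico] at hm
    have h1 : m ≠ 0 := by omega
    have h2 : ¬ m ≤ min (N / 2) (Np / 2) := by omega
    have h3 : ¬ (N ≤ Np ∧ N / 2 + 1 ≤ m ∧ m ≤ min N (M / 2)) := by omega
    have h4 : ¬ (N ≤ Np ∧ M / 2 + 1 ≤ m ∧ m ≤ N ∧ (M - N) % 2 = 0) := by omega
    have h5 : ¬ (N ≤ Np ∧ N + 1 ≤ m ∧ m ≤ M / 2) := by omega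
    have h6 : ¬ (N ≤ Np ∧ max (N + 1) (M / 2 + 1) ≤ m ∧ m ≤ (M + N) / 2 ∧ (M - N) % 2 = 0) := by omega
    simp only [iThirteen, if_neg h1, if_neg h2, if_neg h3, if_neg h4, if_neg h5, if_neg h6]
  rw [h0, hA, hBD, hCE, hZ]
  ring

/-- **Prop. 13's table summed, regime `N₊ < N`**: only case (a) survives (`K = [N₊∕2]`). [cite: Flicker1998UnitaryFL, Prop. 13 p. 91] -/
theorem innerSumThirteen_eq_of_lt (q : ℕ) {N Np : ℕ} (h : Np < N) (M : ℕ) :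
    innerSumThirteen q N Np M = 1 + (1 - ((q : ℚ) ^ 2)⁻¹) * ∑ m ∈ Ico 1 (Np / 2 + 1), (q : ℚ) ^ (4 * m) := by
  unfold innerSumThirteen
  rw [Finset.range_eq_Ico, Finset.sum_eq_sum_Ico_succ_bot (by omega : 0 < M + N + 1),
    ← Finset.sum_Ico_consecutive _ (by omega : 1 ≤ Np / 2 + 1) (by omega : Np / 2 + 1 ≤ M + N + 1)]
  have h0 : iThirteen q N Np M 0 = 1 := by simp [iThirteen]
  have hA : ∑ m ∈ Ico 1 (Np / 2 + 1), iThirteen q N Np M m = (1 - ((q : ℚ) ^ 2)⁻¹) * ∑ m ∈ Ico 1 (Np / 2 + 1), (q : ℚ) ^ (4 * m) := by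
    rw [Finset.mul_sum]
    refine Finset.sum_congr rfl fun m hm => ?_
    rw [Finset.mem_Ico] at hm
    have h1 : m ≠ 0 := by omega
    have h2 : m ≤ min (N / 2) (Np / 2) := by omega
    simp only [iThirteen, if_neg h1, if_pos h2]
  have hZ : ∑ m ∈ Ico (Np / 2 + 1) (M + N + 1), iThirteen q N Np M m = 0 := by
    refine Finset.sum_eq_zero fun m hm => ?_
    rw [Finset.mem_Ico] at hm
    have h1 : m ≠ 0 := by omega
    have h2 : ¬ m ≤ min (N / 2) (Np / 2) := by omega
    have hn : ¬ N ≤ Np := by omega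
    simp only [iThirteen, if_neg h1, if_neg h2, hn, false_and, if_false]
  rw [h0, hA, hZ, add_zero]

/-! ## §3 Prop. 14: Cor. 9's `θ̄ = 0` sum in closed form -/

/-- **Cor. 9's `θ̄ = 0` sum in CLOSED FORM, regime `N ≤ N₊`, `N ≤ M`** (Prop. 14, case «`N ≤ N₁`» with `M = max(N₁,N₂)`):
`Σ = −A(1 + q^{2+4[N∕2]}) − (−q)^{M+N}∕(q−1) + δ(2 ∣ M−N)·B·q^{2N+M}`. [cite: Flicker1998UnitaryFL, Prop. 14 p. 94] -/
theorem sumThetaZero_eq_of_le (hq : 1 < q) {N Np M : ℕ} (hN : N ≤ Np) (hM : N ≤ M) :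
    sumThetaZero q N Np M = -(((q : ℚ) + 1) / ((q : ℚ) ^ 4 - 1)) * (1 + (q : ℚ) ^ (2 + 4 * (N / 2))) - (-(q : ℚ)) ^ (M + N) / ((q : ℚ) - 1)
      + (if (M - N) % 2 = 0 then ((q : ℚ) + 1) / ((q : ℚ) - 1) * (q : ℚ) ^ (2 * N + M) else 0) := by
  have h1 := cast_sub_one_ne_zero hq
  have h2 := cast_pow_sub_one_ne_zero hq (by norm_num : 0 < 2)
  have h4 := cast_pow_four_sub_one_ne_zero hq
  have hq0 : (q : ℚ) ≠ 0 := by exact_mod_cast (by omega : q ≠ 0)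
  unfold sumThetaZero
  rw [innerSumThirteen_eq_of_le q hN hM, sumThetaZeroJ_eq hq, sum_Ico_one_pow_four hq,
    sum_Ico_pow_mul hq (by norm_num : 0 < 2) (by omega : N / 2 + 1 ≤ M / 2 + 1),
    sum_Ico_pow_mul hq (by norm_num : 0 < 2) (by omega : M / 2 + 1 ≤ (M + N) / 2 + 1)]
  have hφ : phiOne q Np (N - 1) = ((q : ℚ) + 1) / ((q : ℚ) ^ 4 - 1) * ((q : ℚ) ^ (4 * (N / 2)) - 1) := by
    simp only [phiOne, if_pos (show N - 1 ≤ Np by omega), show (N - 1 + 1) / 2 = N / 2 by omega]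
  rw [hφ]
  obtain ⟨a, rfl | rfl⟩ := Nat.even_or_odd' N
  · -- N = 2a
    rw [show 2 * a / 2 = a by omega]
    obtain ⟨d, hd | hd⟩ := Nat.even_or_odd' (M - 2 * a)
    · -- M = 2a + 2d
      have hpar : (M - 2 * a) % 2 = 0 := by omega
      rw [show M / 2 = a + d by omega, show (M + 2 * a) / 2 = 2 * a + d by omega,
        show (-(q : ℚ)) ^ (M + 2 * a) = (q : ℚ) ^ (M + 2 * a) from Even.neg_pow ⟨2 * a + d, by omega⟩ _,
        show M + 2 * a = 4 * a + 2 * d by omega, show 2 * (2 * a) + M = 6 * a + 2 * d by omega]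
      simp only [hpar, ↓reduceIte]
      field_simp
      ring
    · -- M = 2a + 2d + 1
      have hpar : ¬ (M - 2 * a) % 2 = 0 := by omega
      rw [show M / 2 = a + d by omega, show (M + 2 * a) / 2 = 2 * a + d by omega,
        show (-(q : ℚ)) ^ (M + 2 * a) = -(q : ℚ) ^ (M + 2 * a) from Odd.neg_pow ⟨2 * a + d, by omega⟩ _,
        show M + 2 * a = 4 * a + 2 * d + 1 by omega]
      simp only [hpar, ↓reduceIte, add_zero]
      field_simp
      ring
  · -- N = 2a + 1
    rw [show (2 * a + 1) / 2 = a by omega]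
    obtain ⟨d, hd | hd⟩ := Nat.even_or_odd' (M - (2 * a + 1))
    · -- M = 2a + 1 + 2d
      have hpar : (M - (2 * a + 1)) % 2 = 0 := by omega
      rw [show M / 2 = a + d by omega, show (M + (2 * a + 1)) / 2 = 2 * a + d + 1 by omega,
        show (-(q : ℚ)) ^ (M + (2 * a + 1)) = (q : ℚ) ^ (M + (2 * a + 1)) from Even.neg_pow ⟨2 * a + d + 1, by omega⟩ _,
        show M + (2 * a + 1) = 4 * a + 2 * d + 2 by omega, show 2 * (2 * a + 1) + M = 6 * a + 2 * d + 3 by omega]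
      simp only [hpar, ↓reduceIte]
      field_simp
      ring
    · -- M = 2a + 2d + 2
      have hpar : ¬ (M - (2 * a + 1)) % 2 = 0 := by omega
      rw [show M / 2 = a + d + 1 by omega, show (M + (2 * a + 1)) / 2 = 2 * a + d + 1 by omega,
        show (-(q : ℚ)) ^ (M + (2 * a + 1)) = -(q : ℚ) ^ (M + (2 * a + 1)) from Odd.neg_pow ⟨2 * a + d + 1, by omega⟩ _,
        show M + (2 * a + 1) = 4 * a + 2 * d + 3 by omega]
      simp only [hpar, ↓reduceIte, add_zero]
      field_simp
      ring

/-- The `N > N₁` branch of ★ `phiOne`, as printed. [cite: Flicker1998UnitaryFL, Prop. 11 p. 87] -/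
theorem phiOne_of_lt (q : ℕ) {N₁ N : ℕ} (h : N₁ < N) :
    phiOne q N₁ N = -(((q : ℚ) + 1) / ((q : ℚ) ^ 4 - 1)) * (1 + (q : ℚ) ^ (2 + 4 * (N₁ / 2))) + (-(q : ℚ)) ^ (N + N₁) / ((q : ℚ) - 1) +
      (if (N - 1 - N₁) % 2 = 0 then ((q : ℚ) + 1) / ((q : ℚ) - 1) * (q : ℚ) ^ (N + 2 * N₁) else 0) := by
  rw [phiOne, if_neg (by omega)]

/-- The `N ≤ N₁` branch of ★ `phiOne`, as printed. [cite: Flicker1998UnitaryFL, Prop. 11 p. 87] -/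
theorem phiOne_of_le (q : ℕ) {N₁ N : ℕ} (h : N ≤ N₁) :
    phiOne q N₁ N = ((q : ℚ) + 1) / ((q : ℚ) ^ 4 - 1) * ((q : ℚ) ^ (4 * ((N + 1) / 2)) - 1) := by
  rw [phiOne, if_pos h]

/-- **Cor. 9's `θ̄ = 0` sum, regime `N₊ < N` (`N₊ = N₁ = N₂ = M`)** = Prop. 14's first printed case ★ `phiZero q N₊ N₊ N`.
[cite: Flicker1998UnitaryFL, Prop. 14 p. 94; Prop. 12 p. 90; Prop. 13 p. 91] -/
theorem sumThetaZero_eq_phiZero_of_lt (hq : 1 < q) {N Np : ℕ} (h : Np < N) :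
    sumThetaZero q N Np Np = phiZero q Np Np N := by
  have h1 := cast_sub_one_ne_zero hq
  have h2 := cast_pow_sub_one_ne_zero hq (by norm_num : 0 < 2)
  have h4 := cast_pow_four_sub_one_ne_zero hq
  have hq0 : (q : ℚ) ≠ 0 := by exact_mod_cast (by omega : q ≠ 0)
  unfold sumThetaZero
  rw [innerSumThirteen_eq_of_lt q h, sumThetaZeroJ_eq hq, sum_Ico_one_pow_four hq, phiZero, if_pos h]
  obtain ⟨b, hb | hb⟩ := Nat.even_or_odd' Np <;> obtain ⟨d, hd | hd⟩ := Nat.even_or_odd' (N - Np)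
  · -- Np = 2b, N = Np + 2d, d ≥ 1
    rw [phiOne_of_lt q (show Np < N - 1 by omega)]
    simp only [show (N - 1 - 1 - Np) % 2 = 0 by omega, show (N + Np) % 2 = 0 by omega, ↓reduceIte]
    rw [show Np / 2 = b by omega,
      show (-(q : ℚ)) ^ (N - 1 + Np) = -(q : ℚ) ^ (N - 1 + Np) from Odd.neg_pow ⟨2 * b + d - 1, by omega⟩ _,
      show (-(q : ℚ)) ^ (N + Np) = (q : ℚ) ^ (N + Np) from Even.neg_pow ⟨2 * b + d, by omega⟩ _,
      show N - 1 + Np = 4 * b + 2 * (d - 1) + 1 by omega, show N + Np = 4 * b + 2 * (d - 1) + 2 by omega,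
      show N - 1 + 2 * Np = 6 * b + 2 * (d - 1) + 1 by omega, show 2 * Np + N = 6 * b + 2 * (d - 1) + 2 by omega]
    field_simp
    ring
  · -- Np = 2b, N = Np + 2d + 1
    rcases Nat.eq_zero_or_pos d with rfl | hd0
    · -- N = Np + 1
      rw [phiOne_of_le q (show N - 1 ≤ Np by omega)]
      simp only [show ¬ (N + Np) % 2 = 0 by omega, ↓reduceIte, add_zero]
      rw [show Np / 2 = b by omega, show (N - 1 + 1) / 2 = b by omega,
        show (-(q : ℚ)) ^ (N + Np) = -(q : ℚ) ^ (N + Np) from Odd.neg_pow ⟨2 * b, by omega⟩ _, show N + Np = 4 * b + 1 by omega]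
      field_simp
      ring
    · rw [phiOne_of_lt q (show Np < N - 1 by omega)]
      simp only [show ¬ (N - 1 - 1 - Np) % 2 = 0 by omega, show ¬ (N + Np) % 2 = 0 by omega, ↓reduceIte, add_zero]
      rw [show Np / 2 = b by omega,
        show (-(q : ℚ)) ^ (N - 1 + Np) = (q : ℚ) ^ (N - 1 + Np) from Even.neg_pow ⟨2 * b + d, by omega⟩ _,
        show (-(q : ℚ)) ^ (N + Np) = -(q : ℚ) ^ (N + Np) from Odd.neg_pow ⟨2 * b + d, by omega⟩ _,
        show N - 1 + Np = 4 * b + 2 * d by omega, show N + Np = 4 * b + 2 * d + 1 by omega]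
      field_simp
      ring
  · -- Np = 2b + 1, N = Np + 2d, d ≥ 1
    rw [phiOne_of_lt q (show Np < N - 1 by omega)]
    simp only [show (N - 1 - 1 - Np) % 2 = 0 by omega, show (N + Np) % 2 = 0 by omega, ↓reduceIte]
    rw [show Np / 2 = b by omega,
      show (-(q : ℚ)) ^ (N - 1 + Np) = -(q : ℚ) ^ (N - 1 + Np) from Odd.neg_pow ⟨2 * b + d, by omega⟩ _,
      show (-(q : ℚ)) ^ (N + Np) = (q : ℚ) ^ (N + Np) from Even.neg_pow ⟨2 * b + d + 1, by omega⟩ _,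
      show N - 1 + Np = 4 * b + 2 * (d - 1) + 3 by omega, show N + Np = 4 * b + 2 * (d - 1) + 4 by omega,
      show N - 1 + 2 * Np = 6 * b + 2 * (d - 1) + 4 by omega, show 2 * Np + N = 6 * b + 2 * (d - 1) + 5 by omega]
    field_simp
    ring
  · -- Np = 2b + 1, N = Np + 2d + 1
    rcases Nat.eq_zero_or_pos d with rfl | hd0
    · rw [phiOne_of_le q (show N - 1 ≤ Np by omega)]
      simp only [show ¬ (N + Np) % 2 = 0 by omega, ↓reduceIte, add_zero]
      rw [show Np / 2 = b by omega, show (N - 1 + 1) / 2 = b + 1 by omega,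
        show (-(q : ℚ)) ^ (N + Np) = -(q : ℚ) ^ (N + Np) from Odd.neg_pow ⟨2 * b + 1, by omega⟩ _, show N + Np = 4 * b + 3 by omega]
      field_simp
      ring
    · rw [phiOne_of_lt q (show Np < N - 1 by omega)]
      simp only [show ¬ (N - 1 - 1 - Np) % 2 = 0 by omega, show ¬ (N + Np) % 2 = 0 by omega, ↓reduceIte, add_zero]
      rw [show Np / 2 = b by omega,
        show (-(q : ℚ)) ^ (N - 1 + Np) = (q : ℚ) ^ (N - 1 + Np) from Even.neg_pow ⟨2 * b + d + 1, by omega⟩ _,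
        show (-(q : ℚ)) ^ (N + Np) = -(q : ℚ) ^ (N + Np) from Odd.neg_pow ⟨2 * b + d + 1, by omega⟩ _,
        show N - 1 + Np = 4 * b + 2 * d + 2 by omega, show N + Np = 4 * b + 2 * d + 3 by omega]
      field_simp
      ring

/-! ## §4 Prop. 14 in Flicker's frame -/

/-- **«Cor. 9 + Props. 10, 12, 13 ⇒ Prop. 14» in Flicker's frame**: in either elliptic regime — «`N₁ < N`» (then `N₊ = N₁ = N₂ = M`, p. 85) or «`N ≤ N₁`, `N ≤ N₊`»
(`M = max(N₁,N₂)`) — Cor. 9's `θ̄ = 0` sum over the printed tables of Props. 10 and 13 IS Prop. 14's closed form ★ `phiZero q N₁ N₂ N`.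
[cite: Flicker1998UnitaryFL, Prop. 14 p. 94; Cor. 9 p. 85; Props. 10, 12, 13 pp. 85–93] -/
theorem sumThetaZero_eq_phiZero (hq : 1 < q) {N₁ N₂ N Np : ℕ}
    (h : (N₁ < N ∧ N₂ = N₁ ∧ Np = N₁) ∨ (N ≤ N₁ ∧ N ≤ Np)) :
    sumThetaZero q N Np (max N₁ N₂) = phiZero q N₁ N₂ N := by
  rcases h with ⟨hlt, rfl, rfl⟩ | ⟨hN1, hNp⟩
  · rw [max_self]; exact sumThetaZero_eq_phiZero_of_lt hq hlt
  · rw [sumThetaZero_eq_of_le hq hNp (le_max_of_le_left hN1), phiZero, if_neg (not_lt.mpr hN1)]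

/-- **The same in the `θ̄ = 1` frame** (for symmetry of citation): Cor. 9's `θ̄ = 1` sum IS Prop. 11's ★ `phiOne q N₁ N` in either regime («`N₁ < N`, `N₊ = N₁`» or
«`N ≤ N₁`, `N ≤ N₊`»). [cite: Flicker1998UnitaryFL, Prop. 11 p. 87] -/
theorem sumThetaOne_eq_phiOne' (hq : 1 < q) {N₁ N Np : ℕ} (h : (N₁ < N ∧ Np = N₁) ∨ (N ≤ N₁ ∧ N ≤ Np)) :
    sumThetaOne q N Np = phiOne q N₁ N := by
  rcases h with ⟨_, rfl⟩ | ⟨hN1, hNp⟩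
  · exact sumThetaOne_eq_phiOne hq N Np
  · rw [sumThetaOne_eq_phiOne hq, phiOne_of_le q hNp, phiOne_of_le q hN1]

end Literature.NumberTheory.Rogawski1990.Flicker1998
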